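import Summits.AnomalousDissipation.AnomalousDissipation.Theses.TwoAndHalfD
import Summits.AnomalousDissipation.AnomalousDissipation.Theorems.TwoAndHalfDScalarAnomalySteadySourceFormalColdStartVarianceToolkit
import Literature.Analysis.FluidPDE.PassiveScalarWellPosednessProofs
import Literature.Analysis.FluidPDE.PassiveScalarClassicalEnergy

/-!
# Duhamel majorant for the sourced passive scalar — toolkit (linearity, short cold starts)

Support file for the stub `stub_duhamelMajorant` (S5) of the line `budgeted-mixer-template` for
the crux `TwoAndHalfD.ScalarAnomalySteadySourceFormal` (stmt-AnomalousDissipation-0448). It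
extends the linear-PDE plumbing of the cold-start toolkit
(`TwoAndHalfDScalarAnomalySteadySourceFormalColdStartVarianceToolkit`) for classical solutions of
`∂ₜθ + u·∇θ = κΔθ (+ s)`, `div u = 0`, on `S × T^d`:

* `partialDeriv_const_mul`, `laplacian_const_mul`, `inner_gradient_const_mul`,
  `inner_gradient_sub` — constant multiples / differences under the torus operators;
* `unforced_sub`, `unforced_const_mul` — linearity of the unforced equation
  (`Torus.IsClassicalScalarTransportOn`) on a time set of unique differentiability;
* `forced_sub_linear` — for a classical solution `θ` of the `h`-sourced equation on `[a, r]`,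
  the field `w(σ) = θ(σ) - (σ - a)h` solves the equation with the TIME-DEPENDENT smooth source
  `-(σ - a)(u·∇h - κΔh)` (the defect of the steady profile `h`);
* `sqrt_scalarL2Sq_le_of_forced_zero` — **the generalised cold-start estimate**: a classical
  solution of `∂ₜρ + u·∇ρ = κΔρ + s` on `[a, b]` (`κ ≥ 0`) from the zero datum with
  `‖s(τ)‖_{L²} ≤ M` obeys `‖ρ(t)‖_{L²} ≤ (t - a)M` (sourced `L²` balance + Cauchy–Schwarz,
  `ε`-regularised square root, as in `ColdStartVariance.sqrt_scalarL2Sq_le_of_coldStart`);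
* `sqrt_integral_coldStart_sub_sq_le` — **short cold starts are `δh + O(δ²)`**:
  `‖θ(r) - (r - a)h‖_{L²} ≤ C(r - a)²` whenever `‖u(σ)·∇h - κΔh‖_{L²} ≤ C` on `[a, r]`;
* `stub_duhamelMajorant_toolkit` — the generalised cold-start estimate on `T²` in closed
  `∀`-form, the registered sub-goal under which this toolkit lands.

Supports stmt-AnomalousDissipation-0448. [folklore: Duhamel's principle; Shaw–Thiffeault–Doering
2007 (I.11)]
-/

-- the summit path `AnomalousDissipation/AnomalousDissipation` duplicates a namespace component
set_option linter.dupNamespace false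

noncomputable section

namespace Summit.AnomalousDissipation.AnomalousDissipation.Theorems.ScalarAnomalySteadySourceFormal.DuhamelMajorant

open MeasureTheory Filter Topology Set
open scoped ENNReal NNReal InnerProductSpace ContDiff
open Literature.Analysis.FunctionSpaces Literature.Analysis.FluidPDE
open Summit.AnomalousDissipation.AnomalousDissipation.Theorems.ScalarAnomalySteadySourceFormal.ColdStartVariance

variable {d : Type*} [Fintype d] [DecidableEq d]

/-! ## Constant multiples and differences under the torus operators -/

section Calculus

/-- `∂ⱼ(c f) = c ∂ⱼf` for smooth `f` on `T^d`. [folklore] -/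
theorem partialDeriv_const_mul {f : UnitAddTorus d → ℝ} (hf : Torus.IsSmooth f) (c : ℝ) (j : d)
    (x : UnitAddTorus d) :
    Torus.partialDeriv j (fun y => c * f y) x = c * Torus.partialDeriv j f x :=
  ((hf.hasDerivAt_line_zero j x).const_mul c).deriv

/-- `Δ(c f) = c Δf` for smooth `f` on `T^d` (`Δ = ∑ᵢ ∂ᵢ∂ᵢ`). [folklore] -/
theorem laplacian_const_mul {f : UnitAddTorus d → ℝ} (hf : Torus.IsSmooth f) (c : ℝ)
    (x : UnitAddTorus d) :
    Torus.laplacian (fun y => c * f y) x = c * Torus.laplacian f x := by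
  have hcf : Torus.IsSmooth (fun y => c * f y) := (Torus.isSmooth_const c).smul' hf
  rw [Torus.laplacian_eq_sum_partialDeriv_partialDeriv hcf,
    Torus.laplacian_eq_sum_partialDeriv_partialDeriv hf, Finset.mul_sum]
  refine Finset.sum_congr rfl fun i _ => ?_
  have h1 : Torus.partialDeriv i (fun y => c * f y) = fun y => c * Torus.partialDeriv i f y :=
    funext fun y => partialDeriv_const_mul hf c i y
  rw [h1, partialDeriv_const_mul (hf.partialDeriv i)]

/-- `⟪v, ∇(c f)⟫ = c ⟪v, ∇f⟫` for smooth `f` on `T^d`. [folklore] -/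
theorem inner_gradient_const_mul {f : UnitAddTorus d → ℝ} (hf : Torus.IsSmooth f) (c : ℝ)
    (v : EuclideanSpace ℝ d) (x : UnitAddTorus d) :
    ⟪v, Torus.gradient (fun y => c * f y) x⟫_ℝ = c * ⟪v, Torus.gradient f x⟫_ℝ := by
  have hcf : Torus.IsSmooth (fun y => c * f y) := (Torus.isSmooth_const c).smul' hf
  rw [Torus.inner_gradient_eq_sum_mul_partialDeriv (hcf.isContDiff (by simp)),
    Torus.inner_gradient_eq_sum_mul_partialDeriv (hf.isContDiff (by simp)), Finset.mul_sum]
  refine Finset.sum_congr rfl fun j _ => ?_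
  rw [partialDeriv_const_mul hf]
  ring

/-- `⟪v, ∇(f - g)⟫ = ⟪v, ∇f⟫ - ⟪v, ∇g⟫` for smooth `f`, `g` on `T^d`. [folklore] -/
theorem inner_gradient_sub {f g : UnitAddTorus d → ℝ} (hf : Torus.IsSmooth f)
    (hg : Torus.IsSmooth g) (v : EuclideanSpace ℝ d) (x : UnitAddTorus d) :
    ⟪v, Torus.gradient (fun y => f y - g y) x⟫_ℝ =
      ⟪v, Torus.gradient f x⟫_ℝ - ⟪v, Torus.gradient g x⟫_ℝ := by
  have hfg : Torus.IsSmooth (fun y => f y - g y) := hf.sub hg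
  rw [Torus.inner_gradient_eq_sum_mul_partialDeriv (hfg.isContDiff (by simp)),
    Torus.inner_gradient_eq_sum_mul_partialDeriv (hf.isContDiff (by simp)),
    Torus.inner_gradient_eq_sum_mul_partialDeriv (hg.isContDiff (by simp)),
    ← Finset.sum_sub_distrib]
  refine Finset.sum_congr rfl fun j _ => ?_
  rw [← mul_sub, ← Torus.partialDeriv_sub' hf hg]

omit [DecidableEq d] in
/-- `‖c g‖_{L²} = |c| ‖g‖_{L²}` in `Real.sqrt` form. [folklore] -/
theorem sqrt_integral_const_mul_sq (c : ℝ) (g : UnitAddTorus d → ℝ) :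
    √(∫ x, (c * g x) ^ 2) = |c| * √(∫ x, g x ^ 2) := by
  have h : (fun x => (c * g x) ^ 2) = fun x => c ^ 2 * g x ^ 2 := funext fun x => by ring
  rw [h, integral_const_mul, Real.sqrt_mul (sq_nonneg c), Real.sqrt_sq_eq_abs]

end Calculus

/-! ## Linearity of the unforced equation -/

section Linear

variable {S : Set ℝ} {κ : ℝ} {u : ℝ → UnitAddTorus d → EuclideanSpace ℝ d}
  {θ φ : ℝ → UnitAddTorus d → ℝ}

/-- **Linearity, differences**: the difference of two classical solutions of
`∂ₜθ + u·∇θ = κΔθ` on a time set of unique differentiability is a classical solution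
(twin of `IsClassicalScalarTransportForcedOn.sub` on a general time set). [folklore] -/
theorem unforced_sub (hU : UniqueDiffOn ℝ S) (h₁ : Torus.IsClassicalScalarTransportOn S κ u θ)
    (h₂ : Torus.IsClassicalScalarTransportOn S κ u φ) :
    Torus.IsClassicalScalarTransportOn S κ u (fun t x => θ t x - φ t x) := by
  refine ⟨h₁.smooth_velocity, h₁.smooth_scalar.sub h₂.smooth_scalar, fun t ht x => ?_,
    h₁.divFree⟩
  have h1t : Torus.IsSmooth (θ t) := h₁.smooth_scalar.isSmooth_slice ht
  have h2t : Torus.IsSmooth (φ t) := h₂.smooth_scalar.isSmooth_slice ht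
  have hdt : Torus.timeDerivWithin S (fun t x => θ t x - φ t x) t x =
      Torus.timeDerivWithin S θ t x - Torus.timeDerivWithin S φ t x :=
    ((h₁.smooth_scalar.hasDerivWithinAt_slice ht x).sub
      (h₂.smooth_scalar.hasDerivWithinAt_slice ht x)).derivWithin (hU t ht)
  have e1 := h₁.transport t ht x
  have e2 := h₂.transport t ht x
  rw [hdt, inner_gradient_sub h1t h2t, Torus.laplacian_sub' h1t h2t]
  linear_combination e1 - e2

/-- **Linearity, constant multiples**: a constant multiple of a classical solution of
`∂ₜθ + u·∇θ = κΔθ` on a time set of unique differentiability is a classical solution. [folklore] -/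
theorem unforced_const_mul (hU : UniqueDiffOn ℝ S)
    (h : Torus.IsClassicalScalarTransportOn S κ u θ) (c : ℝ) :
    Torus.IsClassicalScalarTransportOn S κ u (fun t x => c * θ t x) := by
  refine ⟨h.smooth_velocity,
    (Torus.isSmoothSpaceTimeOn_const (Torus.isSmooth_const c) S).mul h.smooth_scalar,
    fun t ht x => ?_, h.divFree⟩
  have h1t : Torus.IsSmooth (θ t) := h.smooth_scalar.isSmooth_slice ht
  have hdt : Torus.timeDerivWithin S (fun t x => c * θ t x) t x =
      c * Torus.timeDerivWithin S θ t x :=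
    ((h.smooth_scalar.hasDerivWithinAt_slice ht x).const_mul c).derivWithin (hU t ht)
  have e1 := h.transport t ht x
  rw [hdt, inner_gradient_const_mul h1t, laplacian_const_mul h1t]
  linear_combination c * e1

end Linear

/-! ## Short cold starts: the defect of the steady profile -/

section ShortColdStart

variable {κ a r : ℝ} {u : ℝ → UnitAddTorus d → EuclideanSpace ℝ d} {hsrc : UnitAddTorus d → ℝ}
  {θ : ℝ → UnitAddTorus d → ℝ}

/-- **The cold start minus the linear profile.** If `θ` is a classical solution of
`∂ₜθ + u·∇θ = κΔθ + h` on `[a, r]` (`a < r`), then `w(σ) := θ(σ) - (σ - a)h` is a classical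
solution on `[a, r]` of the equation with the time-dependent source
`S(σ) = -(σ - a)(u(σ)·∇h - κΔh)` (`∂σ[(σ - a)h] = h` cancels the source `h`; the transport and
diffusion of the steady profile `(σ - a)h` make up `S`). [folklore] -/
theorem forced_sub_linear (har : a < r)
    (h : Torus.IsClassicalScalarTransportForcedOn (Icc a r) κ u (fun _ => hsrc) θ) :
    Torus.IsClassicalScalarTransportForcedOn (Icc a r) κ u
      (fun σ x => -((σ - a) *
        (⟪u σ x, Torus.gradient hsrc x⟫_ℝ - κ * Torus.laplacian hsrc x)))
      (fun σ x => θ σ x - (σ - a) * hsrc x) := by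
  have hU : UniqueDiffOn ℝ (Icc a r) := uniqueDiffOn_Icc har
  have hsm : Torus.IsSmooth hsrc := h.smooth_source.isSmooth_slice (left_mem_Icc.2 har.le)
  -- the affine-in-time coefficient and the defect of `h` are jointly smooth
  have hlin : Torus.IsSmoothSpaceTimeOn (Icc a r) (fun (σ : ℝ) (_ : UnitAddTorus d) => σ - a) := by
    show ContDiffOn ℝ ∞ (fun p : ℝ × EuclideanSpace ℝ d => p.1 - a) (Icc a r ×ˢ univ)
    exact (contDiff_fst.sub contDiff_const).contDiffOn
  have hF : Torus.IsSmoothSpaceTimeOn (Icc a r)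
      (fun σ x => ⟪u σ x, Torus.gradient hsrc x⟫_ℝ - κ * Torus.laplacian hsrc x) :=
    (h.smooth_velocity.inner (Torus.isSmoothSpaceTimeOn_const hsm.gradient _)).sub
      (Torus.isSmoothSpaceTimeOn_const ((Torus.isSmooth_const κ).smul' hsm.laplacian) _)
  refine ⟨h.smooth_velocity, (hlin.mul hF).neg,
    h.smooth_scalar.sub (hlin.mul (Torus.isSmoothSpaceTimeOn_const hsm _)),
    fun σ hσ x => ?_, h.divFree⟩
  have hθσ : Torus.IsSmooth (θ σ) := h.smooth_scalar.isSmooth_slice hσ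
  have hch : Torus.IsSmooth (fun y => (σ - a) * hsrc y) := (Torus.isSmooth_const _).smul' hsm
  -- the one-sided time derivative of `w`
  have hdt : Torus.timeDerivWithin (Icc a r) (fun σ x => θ σ x - (σ - a) * hsrc x) σ x =
      Torus.timeDerivWithin (Icc a r) θ σ x - hsrc x := by
    have h1 : HasDerivWithinAt (fun τ => (τ - a) * hsrc x) (1 * hsrc x) (Icc a r) σ :=
      ((hasDerivWithinAt_id σ _).sub_const a).mul_const (hsrc x)
    have h2 := ((h.smooth_scalar.hasDerivWithinAt_slice hσ x).sub h1).derivWithin (hU σ hσ)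
    rw [one_mul] at h2
    exact h2
  have e := h.transport σ hσ x
  rw [hdt, inner_gradient_sub hθσ hch, inner_gradient_const_mul hsm, Torus.laplacian_sub' hθσ hch,
    laplacian_const_mul hsm]
  linear_combination e

end ShortColdStart

/-! ## The generalised cold-start estimate -/

section ColdStart

variable {a b κ M : ℝ} {u : ℝ → UnitAddTorus d → EuclideanSpace ℝ d}
  {s ρ : ℝ → UnitAddTorus d → ℝ}

/-- **Generalised cold-start estimate.** A classical solution `ρ` of `∂ₜρ + u·∇ρ = κΔρ + s` on
`[a, b] × T^d` (`κ ≥ 0`, `a < b`, jointly smooth time-dependent source `s`) with `ρ(a) = 0`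
and `‖s(τ)‖_{L²} ≤ M` on `[a, b]` obeys `‖ρ(t)‖_{L²} ≤ (t - a)M` for `t ∈ [a, b]`: by the
sourced balance (`forced_hasDerivWithinAt_scalarL2Sq`) and Cauchy–Schwarz `(‖ρ‖²)' ≤ 2M‖ρ‖`,
so for every `ε > 0` the function `t ↦ (‖ρ(t)‖² + ε²)^{1/2} - (t - a)M` is non-increasing on
`[a, b]` (Mathlib `antitoneOn_of_hasDerivWithinAt_nonpos`); let `ε → 0`. (Same proof as
`ColdStartVariance.sqrt_scalarL2Sq_le_of_coldStart`, which is the steady case `s = h`,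
`M = ‖h‖`; Shaw–Thiffeault–Doering 2007, (I.11).) [folklore] -/
theorem sqrt_scalarL2Sq_le_of_forced_zero (hκ : 0 ≤ κ) (hab : a < b)
    (h : Torus.IsClassicalScalarTransportForcedOn (Icc a b) κ u s ρ)
    (h0 : ρ a = fun _ => 0) (hM : ∀ τ ∈ Icc a b, √(Torus.scalarL2Sq (s τ)) ≤ M)
    {t : ℝ} (ht : t ∈ Icc a b) :
    √(Torus.scalarL2Sq (ρ t)) ≤ (t - a) * M := by
  set L : ℝ → ℝ := fun τ => Torus.scalarL2Sq (ρ τ) with hL_def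
  have hconv : Convex ℝ (Icc a b) := convex_Icc a b
  have hLnn : ∀ τ, 0 ≤ L τ := fun τ => Torus.scalarL2Sq_nonneg _
  -- the balance and the Cauchy–Schwarz bound on its right-hand side
  set D : ℝ → ℝ := fun τ => -(2 * κ) * Torus.scalarGradNormSq (ρ τ) + 2 * ∫ x, ρ τ x * s τ x
    with hD_def
  have hder : ∀ τ ∈ Icc a b, HasDerivWithinAt L (D τ) (Icc a b) τ := fun τ hτ =>
    forced_hasDerivWithinAt_scalarL2Sq h hconv hτ
  have hbound : ∀ τ ∈ Icc a b, D τ ≤ 2 * M * √(L τ) := by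
    intro τ hτ
    have hρτ : Torus.IsSmooth (ρ τ) := h.smooth_scalar.isSmooth_slice hτ
    have hsτ : Torus.IsSmooth (s τ) := h.smooth_source.isSmooth_slice hτ
    have hcs : ∫ x, ρ τ x * s τ x ≤ √(L τ) * √(Torus.scalarL2Sq (s τ)) :=
      integral_mul_le_sqrt_mul_sqrt (hρτ.memLp 2) (hsτ.memLp 2)
    have hcs' : ∫ x, ρ τ x * s τ x ≤ √(L τ) * M :=
      hcs.trans (mul_le_mul_of_nonneg_left (hM τ hτ) (Real.sqrt_nonneg _))
    have hnn : 0 ≤ 2 * κ * Torus.scalarGradNormSq (ρ τ) :=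
      mul_nonneg (mul_nonneg two_pos.le hκ) (Torus.scalarGradNormSq_nonneg _)
    simp only [hD_def]
    nlinarith
  have hLcont : ContinuousOn L (Icc a b) := fun τ hτ => (hder τ hτ).continuousWithinAt
  have hL0 : L a = 0 := by simp [hL_def, h0, Torus.scalarL2Sq]
  -- `ε`-regularisation of the square root
  refine le_of_forall_pos_le_add fun ε hε => ?_
  set G : ℝ → ℝ := fun τ => √(L τ + ε ^ 2) - (τ - a) * M with hG_def
  have hGcont : ContinuousOn G (Icc a b) :=
    ((hLcont.add continuousOn_const).sqrt).sub
      ((continuousOn_id.sub continuousOn_const).mul continuousOn_const)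
  have hGder : ∀ x ∈ interior (Icc a b),
      HasDerivWithinAt G (D x / (2 * √(L x + ε ^ 2)) - M) (interior (Icc a b)) x := by
    intro x hx
    rw [interior_Icc] at hx ⊢
    have hxI : x ∈ Icc a b := Ioo_subset_Icc_self hx
    have hne : L x + ε ^ 2 ≠ 0 := (add_pos_of_nonneg_of_pos (hLnn x) (pow_pos hε 2)).ne'
    have h1 : HasDerivWithinAt (fun τ => L τ + ε ^ 2) (D x) (Icc a b) x :=
      (hder x hxI).add_const (ε ^ 2)
    have h2 := h1.sqrt hne
    have h3 : HasDerivWithinAt (fun τ => (τ - a) * M) (1 * M) (Icc a b) x :=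
      ((hasDerivWithinAt_id x _).sub_const a).mul_const M
    have h4 := (h2.sub h3).mono Ioo_subset_Icc_self
    rw [one_mul] at h4
    exact h4
  have hGnonpos : ∀ x ∈ interior (Icc a b), D x / (2 * √(L x + ε ^ 2)) - M ≤ 0 := by
    intro x hx
    rw [interior_Icc] at hx
    have hxI : x ∈ Icc a b := Ioo_subset_Icc_self hx
    have hpos : 0 < 2 * √(L x + ε ^ 2) :=
      mul_pos two_pos (Real.sqrt_pos.2 (add_pos_of_nonneg_of_pos (hLnn x) (pow_pos hε 2)))
    have hmono : √(L x) ≤ √(L x + ε ^ 2) := Real.sqrt_le_sqrt (by nlinarith)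
    have hM0 : 0 ≤ M := (Real.sqrt_nonneg _).trans (hM x hxI)
    rw [sub_nonpos, div_le_iff₀ hpos]
    nlinarith [hbound x hxI]
  have hanti := antitoneOn_of_hasDerivWithinAt_nonpos hconv hGcont hGder hGnonpos
  have hGa : G a = ε := by
    simp only [hG_def, hL0, zero_add, sub_self, zero_mul, sub_zero]
    exact Real.sqrt_sq hε.le
  have hle : G t ≤ G a := hanti (left_mem_Icc.2 hab.le) ht ht.1
  rw [hGa] at hle
  have hmono : √(L t) ≤ √(L t + ε ^ 2) := Real.sqrt_le_sqrt (by nlinarith)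
  simp only [hG_def] at hle
  linarith

/-- **Short cold starts are `δh + O(δ²)`.** For a classical solution `θ` of
`∂ₜθ + u·∇θ = κΔθ + h` on `[a, r] × T^d` (`κ ≥ 0`, `a < r`) from the zero datum, with the
defect of the steady profile bounded in `L²`, `‖u(σ)·∇h - κΔh‖_{L²} ≤ C` for `σ ∈ [a, r]`:
`‖θ(r) - (r - a)h‖_{L²} ≤ C(r - a)²` (the generalised cold-start estimate for
`w = θ - (σ - a)h`, `forced_sub_linear`, whose source has `L²` norm `≤ (r - a)C`). [folklore] -/
theorem sqrt_integral_coldStart_sub_sq_le {r C : ℝ} {hsrc : UnitAddTorus d → ℝ}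
    {θ : ℝ → UnitAddTorus d → ℝ} (hκ : 0 ≤ κ) (har : a < r)
    (h : Torus.IsClassicalScalarTransportForcedOn (Icc a r) κ u (fun _ => hsrc) θ)
    (h0 : θ a = fun _ => 0)
    (hC : ∀ σ ∈ Icc a r,
      √(∫ x, (⟪u σ x, Torus.gradient hsrc x⟫_ℝ - κ * Torus.laplacian hsrc x) ^ 2) ≤ C) :
    √(∫ x, (θ r x - (r - a) * hsrc x) ^ 2) ≤ C * (r - a) ^ 2 := by
  have hw := forced_sub_linear har h
  have hw0 : (fun σ x => θ σ x - (σ - a) * hsrc x) a = fun _ => 0 := by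
    funext x
    simp [h0]
  have hC0 : 0 ≤ C := (Real.sqrt_nonneg _).trans (hC a (left_mem_Icc.2 har.le))
  have hM : ∀ τ ∈ Icc a r, √(Torus.scalarL2Sq ((fun σ x => -((σ - a) *
      (⟪u σ x, Torus.gradient hsrc x⟫_ℝ - κ * Torus.laplacian hsrc x))) τ)) ≤ (r - a) * C := by
    intro τ hτ
    have hτa : 0 ≤ τ - a := sub_nonneg.2 hτ.1
    have heq : Torus.scalarL2Sq ((fun σ x => -((σ - a) *
        (⟪u σ x, Torus.gradient hsrc x⟫_ℝ - κ * Torus.laplacian hsrc x))) τ) =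
        ∫ x, ((τ - a) * (⟪u τ x, Torus.gradient hsrc x⟫_ℝ - κ * Torus.laplacian hsrc x)) ^ 2 := by
      simp only [Torus.scalarL2Sq, neg_sq]
    rw [heq, sqrt_integral_const_mul_sq, abs_of_nonneg hτa]
    exact mul_le_mul (by linarith [hτ.2]) (hC τ hτ) (Real.sqrt_nonneg _) (by linarith [har])
  have hest := sqrt_scalarL2Sq_le_of_forced_zero hκ har hw hw0 hM (right_mem_Icc.2 har.le)
  have heq : Torus.scalarL2Sq ((fun σ x => θ σ x - (σ - a) * hsrc x) r) =
      ∫ x, (θ r x - (r - a) * hsrc x) ^ 2 := rfl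
  rw [heq] at hest
  calc √(∫ x, (θ r x - (r - a) * hsrc x) ^ 2) ≤ (r - a) * ((r - a) * C) := hest
    _ = C * (r - a) ^ 2 := by ring

end ColdStart

/-! ## Registered form of the toolkit's deciding estimate -/

/-- **The generalised cold-start estimate, registered form** (sub-goal
`stub_duhamelMajorant_toolkit` of stmt-AnomalousDissipation-0448, serving stub S5
`stub_duhamelMajorant` of the line `budgeted-mixer-template`): on `T²`, a classical solution `ρ`
of `∂ₜρ + u·∇ρ = κΔρ + s` on `[a, b]` (`κ ≥ 0`, `a < b`) with `ρ(a) = 0` and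
`‖s(τ)‖_{L²} ≤ M` on `[a, b]` has `‖ρ(t)‖_{L²} ≤ (t - a)M` for `t ∈ [a, b]`
(`sqrt_scalarL2Sq_le_of_forced_zero`). [folklore] -/
theorem stub_duhamelMajorant_toolkit :
    ∀ (a b κ M : ℝ) (u : ℝ → UnitAddTorus (Fin 2) → EuclideanSpace ℝ (Fin 2))
      (s ρ : ℝ → UnitAddTorus (Fin 2) → ℝ),
      0 ≤ κ → a < b →
      Torus.IsClassicalScalarTransportForcedOn (Set.Icc a b) κ u s ρ →
      ρ a = (fun _ => (0 : ℝ)) →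
      (∀ τ ∈ Set.Icc a b, Real.sqrt (Torus.scalarL2Sq (s τ)) ≤ M) →
      ∀ t ∈ Set.Icc a b, Real.sqrt (Torus.scalarL2Sq (ρ t)) ≤ (t - a) * M :=
  fun _ _ _ _ _ _ _ hκ hab hρ h0 hM _ ht => sqrt_scalarL2Sq_le_of_forced_zero hκ hab hρ h0 hM ht

end Summit.AnomalousDissipation.AnomalousDissipation.Theorems.ScalarAnomalySteadySourceFormal.DuhamelMajorant

end
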